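import Summits.QuantumFields.BalabanUV.Beta.FP.NestedDressingStepLaw
import Summits.QuantumFields.BalabanUV.Beta.FP.KKTSecondVariation

/-!
# `BalabanUV.Beta.FP.NestedDressingHessian` — road «FP» for binder row D1, RULING R-FP-45 (B) row **SDF-EXACT AT MODEL LEVEL** (owner, gen 15):
# THE SECOND VARIATION OF THE NESTED STEP LAW ALONG A `C²` BACKGROUND CURVE — for EVERY symmetric form curve `u ↦ H(u)`, the one-loop functional
# (`2·(½·tadpole − ½·bubble)` = `secondVar`) of the nested-dressed (m+1)-fold one-shot system IS the ONE-STEP-dressed fine one PLUS the block one: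
# `secondVar 𝕂_nest = secondVar 𝕂₁ + secondVar 𝕂_blk` at `u = 0`, and in the three covariances `Γ = flucCov`:
# `½tr(Γ_N K̇_N Γ_N K̇_N) − ½tr(Γ_N K̈_N) = [½tr(Γ₁ K̇₁ Γ₁ K̇₁) − ½tr(Γ₁ K̈₁)] + [½tr(Γ_B Ė Γ_B Ė) − ½tr(Γ_B Ë)]` — ZERO STEP DEFECT, JET BY JET

HONEST DEPENDENCY (page 1, mandatory): continuum YM on T⁴ ⇐ BetaPertH ∧ nine spine estimates (0/9 proved); BetaPertH ⇐ (D1) ∧ (D4) ∧ CAP+tail;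
G-an2-4 gates asym, D1 and NE2/3/4.  HONEST FRAMING (cell contract, verbatim): «discharging `BetaPertH` makes Bałaban's UV stability UNCONDITIONAL —
a real constructive-QFT result; it is NOT the continuum limit and NOT the Clay problem.»  THIS MODULE DISCHARGES NOTHING of the wall: it is [folklore]
finite-dimensional linear algebra ∕ one-variable calculus composed BY NAME from the owner's `NestedDressingStepLaw` (gen 14: `det_kkt_comp_nestedDressed`,
`log_abs_det_kkt_comp_nestedDressed`, `det_kkt_nestedDressed_eq_fineDressed`), road BF-x's `D1BFx.LogDetSecondVariation.secondVar_comb_eq_zero` (Jacobi twice +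
uniqueness of derivatives), `D1BFx.SliceTransferModel.hasDerivAt_kkt` and `FP.KKTSecondVariation.sixLoops_kkt_of_Q_static`.  No `def`, no `def … : Prop`, nothing
cited, 0 sorry; 0∕4 row-D1 binders; NOT SDF for the literal's perfect objects (that is the KERNEL-level road instance, rows (β)∕(β-c)∕N-kill∕N-fine∕N-desc of memo
`HOME/b2b-balaban-beta-d1-p3/N2B-DESIGN.md` v2.1 §9 (9f)), NOT D1, NOT BetaPertH, NOT continuum, NOT Clay.  «not in print; our bookkeeping».

ABSOLUTE RULE (cell charter, verbatim): «No internally-minted statement may enter as a cited fact. Every hypothesis is either kernel-proved in this package or a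
verbatim quotation of a PUBLISHED theorem with page reference. The manuscript(s) under audit are NOT citable for their own disputed steps — they are the thing
under adjudication; programme-internal (2001/route/tribunal) claims are never citable.»

WHY (memo §9 (9d)∕(9f), RULING R-FP-45 (B) ADOPTED journal l.33687).  The END's binder `hSDF` (`RoadLeftAssemblySDF.d1Drift_left_of_sliceLedger_sdf`) says that the
explicit fixed-point defect `D m = TP (m+1) − RP m − TP m` of the one-loop kernels `TP n = hessKer …` (`½·tadpole − ½·bubble`) has zero `(μ,ν)` second moment.
Gen 14 typed the DETERMINANT-level reason under nested dressing: `log|det 𝕂_nest(H)| = log|det 𝕂₁(H)| + log|det 𝕂_blk(H)| + c` with `c` INDEPENDENT of the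
form `H` (`log_abs_det_kkt_comp_nestedDressed`).  THIS FILE differentiates that identity twice along an arbitrary `C²` curve `u ↦ H(u)` (the background enters
through the form only — the nested projector kills ALL composite gauge directions, so every constraint and every Faddeev–Popov factor is static): the three
one-loop functionals ADD, i.e. the step defect of the SECOND JETS vanishes — the model of `D m = 0` AS A KERNEL.  The block curve is displayed as ANY `C²` curve `E`
that coincides near `0` with the effective block form `(effForm (Π_nestᵀH(u)Π_nest) [Q₁;τ₁])₁₁` (pattern of `HorizontalModel.secondVar_threeSystems`); its jets
`Ė(0)`, `Ë(0)` are the COARSE TABLES the road's (j, m)-families must reproduce at the perfect objects (rows (J-S)∕(J-W); made explicit in the successor file).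

CONTENTS ([folklore]; data as in `NestedDressingStepLaw.det_kkt_comp_nestedDressed`: `Q₁` fine averaging with right inverse `Qʳ`, dressing slices `S₁` ∕ `S^c`,
composite gauge directions `W₁` (`Q₁W₁ = 0`) ∕ `W₂`, transversal slices `τ₁`, `τ₂`, `P`, second averaging `Q₂` (`Q₂Q₁W₂ = 0`);
`Π_nest := 1 − [W₂|W₁]([S^cQ₁;S₁][W₂|W₁])⁻¹[S^cQ₁;S₁]`, `Π₁ := 1 − W₁(S₁W₁)⁻¹S₁`, all inline):
* §0 `hasDerivAt_conj` — `(L·X(u)·R)′ = L·X′·R` for constant `L`, `R` (calculus plumbing).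
* §1 `det_kkt_oneShot_nestedDressed_ne_zero` — the nested one-shot bordered determinant is non-zero as soon as the one-step-dressed fine one and the block one are
  (any field; from `det_kkt_comp_nestedDressed`).
* §2 **`secondVar_nestedStepLaw`** — THE SECOND VARIATION OF THE NESTED STEP LAW along a `C²` form curve (`secondVar` of the three bordered curves at `u = 0`).
* §3 **`hessWords_nestedStepLaw`** — the same in the `½·tadpole − ½·bubble` normalisation of `ExpKernelCalculus.hessKer`, every word written with the fluctuation
  covariance `flucCov` of its own system (`sixLoops_kkt_of_Q_static` ×3): the MODEL of `TP (m+1) = RP m + TP m`.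
Provenance: road FP OWNER b2b-balaban-beta-d1-p3 gen 15 (prover-b2b-balaban-beta-d1-p3-g15-0), 2026-08-21; rows SDF-EXACT (model), (J-S)∕(J-W) targets.  Orientation only
(nothing quoted is load-bearing): the composition of renormalization transformations with gauge fixing at each level is the subject of [Balaban1987RG1] §1 (1.1)–(1.22)
pp. 255–264; this file's content is textbook calculus of `log|det|`.
-/

noncomputable section

namespace Summit.QuantumFields.BalabanUV.Beta.FP.NestedDressingHessian

open Matrix Filter Finset
open scoped Topology
open Literature.MathematicalPhysics.QuantumFieldTheory.Balaban1983to89.Beta.Composition (kkt)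
open Literature.MathematicalPhysics.QuantumFieldTheory.Balaban1983to89.Beta.CompositionSingular (effForm flucCov)
open Literature.Analysis.Calculus (eventually_det_ne_zero)
open Summit.QuantumFields.BalabanUV.Beta.D1BFx.LogDetSecondVariation (secondVar secondVar_comb_eq_zero)
open Summit.QuantumFields.BalabanUV.Beta.D1BFx.SliceTransferModel (hasDerivAt_kkt hasDerivAt_const_mul hasDerivAt_matMul)
open Summit.QuantumFields.BalabanUV.Beta.FP.NestedDressingStepLaw (det_kkt_comp_nestedDressed log_abs_det_kkt_comp_nestedDressed
  det_kkt_nestedDressed_eq_fineDressed)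
open Summit.QuantumFields.BalabanUV.Beta.FP.KKTSecondVariation (sixLoops_kkt_of_Q_static)

/-! ## §0 Calculus plumbing: a curve sandwiched between constant matrices -/

section Plumbing

variable {ι κ θ θ' : Type*} [Fintype ι] [Fintype κ] [Fintype θ] [Fintype θ']

omit [Fintype ι] in
/-- [folklore] `(L·X(u)·R)′ = L·X′(u)·R` for constant matrices `L`, `R`. -/
theorem hasDerivAt_conj {X : ℝ → θ → κ → ℝ} {X' : Matrix θ κ ℝ} {t : ℝ} (L : Matrix ι θ ℝ) (R : Matrix κ θ' ℝ)
    (hX : HasDerivAt X (Matrix.of.symm X') t) :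
    HasDerivAt (fun u => Matrix.of.symm (L * Matrix.of (X u) * R)) (Matrix.of.symm (L * X' * R)) t := by
  have h1 : HasDerivAt (fun u => Matrix.of.symm (L * Matrix.of (X u))) (Matrix.of.symm (L * X')) t := hasDerivAt_const_mul L hX
  have h0 : HasDerivAt (fun _ : ℝ => Matrix.of.symm R) (Matrix.of.symm (0 : Matrix κ θ' ℝ)) t := by
    have h := hasDerivAt_const t (Matrix.of.symm R)
    exact h
  have h2 := hasDerivAt_matMul (X := fun u => Matrix.of.symm (L * Matrix.of (X u))) (Y := fun _ => Matrix.of.symm R)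
    (Y' := (0 : Matrix κ θ' ℝ)) h1 h0
  simpa only [Matrix.mul_zero, add_zero, Equiv.apply_symm_apply] using h2

end Plumbing

/-! ## §1 Non-degeneracy of the nested one-shot system -/

section NeZero

variable {𝕜 : Type*} [Field 𝕜]
variable {ν μ κ ρ₁ ρ₂ : Type*} [Fintype ν] [Fintype μ] [Fintype κ] [Fintype ρ₁] [Fintype ρ₂]
  [DecidableEq ν] [DecidableEq μ] [DecidableEq κ] [DecidableEq ρ₁] [DecidableEq ρ₂]

/-- [folklore] **THE NESTED ONE-SHOT BORDERED DETERMINANT IS NON-ZERO** whenever the ONE-STEP-dressed fine system and the block system are non-degenerate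
(data as in `NestedDressingStepLaw.det_kkt_comp_nestedDressed`; the product identity there has only non-zero factors on the right). -/
theorem det_kkt_oneShot_nestedDressed_ne_zero (H : Matrix ν ν 𝕜) (Q₁ : Matrix μ ν 𝕜) (S₁ : Matrix ρ₁ ν 𝕜) (Sc : Matrix ρ₂ μ 𝕜)
    (W₁ : Matrix ν ρ₁ 𝕜) (W₂ : Matrix ν ρ₂ 𝕜) (hQW₁ : Q₁ * W₁ = 0) (hT : IsUnit (S₁ * W₁).det) (hTc : IsUnit (Sc * (Q₁ * W₂)).det)
    (Qr : Matrix ν μ 𝕜) (hQr : Q₁ * Qr = 1)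
    (τ₁ : Matrix ρ₁ ν 𝕜) (hτ : IsUnit (τ₁ * W₁).det) (Q₂ : Matrix κ μ 𝕜) (hQQW₂ : Q₂ * (Q₁ * W₂) = 0) (τ₂ : Matrix ρ₂ μ 𝕜)
    (hτc : IsUnit (τ₂ * (Q₁ * W₂)).det) (P : Matrix (ρ₂ ⊕ ρ₁) ν 𝕜) (hP : IsUnit (P * fromCols W₂ W₁).det)
    (h1 : (kkt ((1 - W₁ * (S₁ * W₁)⁻¹ * S₁)ᵀ * H * (1 - W₁ * (S₁ * W₁)⁻¹ * S₁)) (fromRows Q₁ τ₁)).det ≠ 0)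
    (h2 : (kkt (effForm ((1 - fromCols W₂ W₁ * (fromRows (Sc * Q₁) S₁ * fromCols W₂ W₁)⁻¹ * fromRows (Sc * Q₁) S₁)ᵀ * H *
          (1 - fromCols W₂ W₁ * (fromRows (Sc * Q₁) S₁ * fromCols W₂ W₁)⁻¹ * fromRows (Sc * Q₁) S₁)) (fromRows Q₁ τ₁)).toBlocks₁₁
          (fromRows Q₂ τ₂)).det ≠ 0) :
    (kkt ((1 - fromCols W₂ W₁ * (fromRows (Sc * Q₁) S₁ * fromCols W₂ W₁)⁻¹ * fromRows (Sc * Q₁) S₁)ᵀ * H *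
        (1 - fromCols W₂ W₁ * (fromRows (Sc * Q₁) S₁ * fromCols W₂ W₁)⁻¹ * fromRows (Sc * Q₁) S₁)) (fromRows (Q₂ * Q₁) P)).det ≠ 0 := by
  have h1' : IsUnit (kkt ((1 - fromCols W₂ W₁ * (fromRows (Sc * Q₁) S₁ * fromCols W₂ W₁)⁻¹ * fromRows (Sc * Q₁) S₁)ᵀ * H *
      (1 - fromCols W₂ W₁ * (fromRows (Sc * Q₁) S₁ * fromCols W₂ W₁)⁻¹ * fromRows (Sc * Q₁) S₁)) (fromRows Q₁ τ₁)).det := by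
    rw [det_kkt_nestedDressed_eq_fineDressed H Q₁ τ₁ S₁ Sc W₁ W₂ hQW₁ hT hTc Qr hQr]; exact isUnit_iff_ne_zero.mpr h1
  have h := det_kkt_comp_nestedDressed H Q₁ S₁ Sc W₁ W₂ hQW₁ hT hTc Qr hQr τ₁ hτ Q₂ hQQW₂ τ₂ hτc P hP h1'
  intro h0
  rw [h0, zero_mul] at h
  exact (mul_ne_zero (mul_ne_zero (pow_ne_zero _ (neg_ne_zero.mpr one_ne_zero)) (mul_ne_zero h1 h2)) (pow_ne_zero _ hP.ne_zero)) h.symm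

end NeZero

/-! ## §2 The second variation of the nested step law along a `C²` form curve -/

section SecondVar

variable {ν μ κ ρ₁ ρ₂ : Type*} [Fintype ν] [Fintype μ] [Fintype κ] [Fintype ρ₁] [Fintype ρ₂]
  [DecidableEq ν] [DecidableEq μ] [DecidableEq κ] [DecidableEq ρ₁] [DecidableEq ρ₂]

/-- [folklore] **THE SECOND VARIATION OF THE NESTED STEP LAW ALONG A `C²` BACKGROUND CURVE** (row SDF-EXACT at MODEL level).  Static data as in
`NestedDressingStepLaw.log_abs_det_kkt_comp_nestedDressed` (`Π_nest`, `Π₁` inline).  Curves: `u ↦ H(u)` (the fine form; first jets `H₁ u` near `0`, second jet `H₂`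
at `0`), and ANY block curve `u ↦ E(u)` (first jets `E₁ u` near `0`, second jet `E₂` at `0`) that COINCIDES near `0` with the effective block form
`(effForm (Π_nestᵀH(u)Π_nest) [Q₁;τ₁])₁₁`; the ONE-STEP-dressed fine system and the block system non-degenerate at `0`.  CONCLUSION at `u = 0`:
`secondVar (kkt (Π_nestᵀHΠ_nest) [Q₂Q₁;P]) (kkt (Π_nestᵀH₁Π_nest) 0) (kkt (Π_nestᵀH₂Π_nest) 0)`
`  = secondVar (kkt (Π₁ᵀHΠ₁) [Q₁;τ₁]) (kkt (Π₁ᵀH₁Π₁) 0) (kkt (Π₁ᵀH₂Π₁) 0) + secondVar (kkt E [Q₂;τ₂]) (kkt E₁ 0) (kkt E₂ 0)`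
— the one-loop functional of the nested-dressed one-shot system IS the literal-dressed fine one PLUS the block one: NO STEP DEFECT for any jet.
Proof: the `log|det|` identity holds with an `H`-independent constant at every `u` near `0` (non-degeneracy persists), then `secondVar_comb_eq_zero`. -/
theorem secondVar_nestedStepLaw (Q₁ : Matrix μ ν ℝ) (S₁ : Matrix ρ₁ ν ℝ) (Sc : Matrix ρ₂ μ ℝ)
    (W₁ : Matrix ν ρ₁ ℝ) (W₂ : Matrix ν ρ₂ ℝ) (hQW₁ : Q₁ * W₁ = 0) (hT : IsUnit (S₁ * W₁).det) (hTc : IsUnit (Sc * (Q₁ * W₂)).det)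
    (Qr : Matrix ν μ ℝ) (hQr : Q₁ * Qr = 1)
    (τ₁ : Matrix ρ₁ ν ℝ) (hτ : IsUnit (τ₁ * W₁).det) (Q₂ : Matrix κ μ ℝ) (hQQW₂ : Q₂ * (Q₁ * W₂) = 0) (τ₂ : Matrix ρ₂ μ ℝ)
    (hτc : IsUnit (τ₂ * (Q₁ * W₂)).det) (P : Matrix (ρ₂ ⊕ ρ₁) ν ℝ) (hP : IsUnit (P * fromCols W₂ W₁).det)
    {H H₁ : ℝ → ν → ν → ℝ} {H₂ : Matrix ν ν ℝ}
    (hH : ∀ᶠ u in 𝓝 (0 : ℝ), HasDerivAt H (H₁ u) u) (hH₁ : HasDerivAt H₁ (Matrix.of.symm H₂) 0)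
    {E E₁ : ℝ → μ → μ → ℝ} {E₂ : Matrix μ μ ℝ}
    (hE : ∀ᶠ u in 𝓝 (0 : ℝ), HasDerivAt E (E₁ u) u) (hE₁ : HasDerivAt E₁ (Matrix.of.symm E₂) 0)
    (hEeq : ∀ᶠ u in 𝓝 (0 : ℝ), Matrix.of (E u) =
      (effForm ((1 - fromCols W₂ W₁ * (fromRows (Sc * Q₁) S₁ * fromCols W₂ W₁)⁻¹ * fromRows (Sc * Q₁) S₁)ᵀ * Matrix.of (H u) *
          (1 - fromCols W₂ W₁ * (fromRows (Sc * Q₁) S₁ * fromCols W₂ W₁)⁻¹ * fromRows (Sc * Q₁) S₁)) (fromRows Q₁ τ₁)).toBlocks₁₁)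
    (h1 : (kkt ((1 - W₁ * (S₁ * W₁)⁻¹ * S₁)ᵀ * Matrix.of (H 0) * (1 - W₁ * (S₁ * W₁)⁻¹ * S₁)) (fromRows Q₁ τ₁)).det ≠ 0)
    (h2 : (kkt (Matrix.of (E 0)) (fromRows Q₂ τ₂)).det ≠ 0) :
    secondVar
        (kkt ((1 - fromCols W₂ W₁ * (fromRows (Sc * Q₁) S₁ * fromCols W₂ W₁)⁻¹ * fromRows (Sc * Q₁) S₁)ᵀ * Matrix.of (H 0) *
            (1 - fromCols W₂ W₁ * (fromRows (Sc * Q₁) S₁ * fromCols W₂ W₁)⁻¹ * fromRows (Sc * Q₁) S₁)) (fromRows (Q₂ * Q₁) P))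
        (kkt ((1 - fromCols W₂ W₁ * (fromRows (Sc * Q₁) S₁ * fromCols W₂ W₁)⁻¹ * fromRows (Sc * Q₁) S₁)ᵀ * Matrix.of (H₁ 0) *
            (1 - fromCols W₂ W₁ * (fromRows (Sc * Q₁) S₁ * fromCols W₂ W₁)⁻¹ * fromRows (Sc * Q₁) S₁)) (0 : Matrix (κ ⊕ (ρ₂ ⊕ ρ₁)) ν ℝ))
        (kkt ((1 - fromCols W₂ W₁ * (fromRows (Sc * Q₁) S₁ * fromCols W₂ W₁)⁻¹ * fromRows (Sc * Q₁) S₁)ᵀ * H₂ *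
            (1 - fromCols W₂ W₁ * (fromRows (Sc * Q₁) S₁ * fromCols W₂ W₁)⁻¹ * fromRows (Sc * Q₁) S₁)) (0 : Matrix (κ ⊕ (ρ₂ ⊕ ρ₁)) ν ℝ))
      = secondVar (kkt ((1 - W₁ * (S₁ * W₁)⁻¹ * S₁)ᵀ * Matrix.of (H 0) * (1 - W₁ * (S₁ * W₁)⁻¹ * S₁)) (fromRows Q₁ τ₁))
          (kkt ((1 - W₁ * (S₁ * W₁)⁻¹ * S₁)ᵀ * Matrix.of (H₁ 0) * (1 - W₁ * (S₁ * W₁)⁻¹ * S₁)) (0 : Matrix (μ ⊕ ρ₁) ν ℝ))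
          (kkt ((1 - W₁ * (S₁ * W₁)⁻¹ * S₁)ᵀ * H₂ * (1 - W₁ * (S₁ * W₁)⁻¹ * S₁)) (0 : Matrix (μ ⊕ ρ₁) ν ℝ))
        + secondVar (kkt (Matrix.of (E 0)) (fromRows Q₂ τ₂)) (kkt (Matrix.of (E₁ 0)) (0 : Matrix (κ ⊕ ρ₂) μ ℝ))
            (kkt E₂ (0 : Matrix (κ ⊕ ρ₂) μ ℝ)) := by
  -- abbreviations for the two dressings
  set PN : Matrix ν ν ℝ := 1 - fromCols W₂ W₁ * (fromRows (Sc * Q₁) S₁ * fromCols W₂ W₁)⁻¹ * fromRows (Sc * Q₁) S₁ with hPN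
  set P1 : Matrix ν ν ℝ := 1 - W₁ * (S₁ * W₁)⁻¹ * S₁ with hP1
  -- the first jets, read as matrices
  have hH' : ∀ᶠ u in 𝓝 (0 : ℝ), HasDerivAt H (Matrix.of.symm (Matrix.of (H₁ u))) u := hH
  have hE' : ∀ᶠ u in 𝓝 (0 : ℝ), HasDerivAt E (Matrix.of.symm (Matrix.of (E₁ u))) u := hE
  -- (N) jets of the nested one-shot bordered curve `u ↦ kkt (PNᵀ H(u) PN) [Q₂Q₁;P]` (static constraints)
  have hNd : ∀ᶠ u in 𝓝 (0 : ℝ), HasDerivAt (fun u => Matrix.of.symm (kkt (PNᵀ * Matrix.of (H u) * PN) (fromRows (Q₂ * Q₁) P)))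
      ((fun u => Matrix.of.symm (kkt (PNᵀ * Matrix.of (H₁ u) * PN) (0 : Matrix (κ ⊕ (ρ₂ ⊕ ρ₁)) ν ℝ))) u) u := by
    filter_upwards [hH'] with u huH
    exact hasDerivAt_kkt (H := fun u => Matrix.of.symm (PNᵀ * Matrix.of (H u) * PN)) (Q := fun _ => Matrix.of.symm (fromRows (Q₂ * Q₁) P))
      (Q' := (0 : Matrix (κ ⊕ (ρ₂ ⊕ ρ₁)) ν ℝ)) (hasDerivAt_conj PNᵀ PN huH) (hasDerivAt_const u _)
  have hN₁d : HasDerivAt (fun u => Matrix.of.symm (kkt (PNᵀ * Matrix.of (H₁ u) * PN) (0 : Matrix (κ ⊕ (ρ₂ ⊕ ρ₁)) ν ℝ)))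
      (Matrix.of.symm (kkt (PNᵀ * H₂ * PN) (0 : Matrix (κ ⊕ (ρ₂ ⊕ ρ₁)) ν ℝ))) 0 :=
    hasDerivAt_kkt (H := fun u => Matrix.of.symm (PNᵀ * Matrix.of (H₁ u) * PN)) (Q := fun _ => Matrix.of.symm (0 : Matrix (κ ⊕ (ρ₂ ⊕ ρ₁)) ν ℝ))
      (Q' := (0 : Matrix (κ ⊕ (ρ₂ ⊕ ρ₁)) ν ℝ)) (hasDerivAt_conj PNᵀ PN hH₁) (hasDerivAt_const (0 : ℝ) _)
  -- (F) jets of the one-step-dressed fine bordered curve `u ↦ kkt (P1ᵀ H(u) P1) [Q₁;τ₁]`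
  have hFd : ∀ᶠ u in 𝓝 (0 : ℝ), HasDerivAt (fun u => Matrix.of.symm (kkt (P1ᵀ * Matrix.of (H u) * P1) (fromRows Q₁ τ₁)))
      ((fun u => Matrix.of.symm (kkt (P1ᵀ * Matrix.of (H₁ u) * P1) (0 : Matrix (μ ⊕ ρ₁) ν ℝ))) u) u := by
    filter_upwards [hH'] with u huH
    exact hasDerivAt_kkt (H := fun u => Matrix.of.symm (P1ᵀ * Matrix.of (H u) * P1)) (Q := fun _ => Matrix.of.symm (fromRows Q₁ τ₁))
      (Q' := (0 : Matrix (μ ⊕ ρ₁) ν ℝ)) (hasDerivAt_conj P1ᵀ P1 huH) (hasDerivAt_const u _)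
  have hF₁d : HasDerivAt (fun u => Matrix.of.symm (kkt (P1ᵀ * Matrix.of (H₁ u) * P1) (0 : Matrix (μ ⊕ ρ₁) ν ℝ)))
      (Matrix.of.symm (kkt (P1ᵀ * H₂ * P1) (0 : Matrix (μ ⊕ ρ₁) ν ℝ))) 0 :=
    hasDerivAt_kkt (H := fun u => Matrix.of.symm (P1ᵀ * Matrix.of (H₁ u) * P1)) (Q := fun _ => Matrix.of.symm (0 : Matrix (μ ⊕ ρ₁) ν ℝ))
      (Q' := (0 : Matrix (μ ⊕ ρ₁) ν ℝ)) (hasDerivAt_conj P1ᵀ P1 hH₁) (hasDerivAt_const (0 : ℝ) _)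
  -- (B) jets of the block bordered curve `u ↦ kkt E(u) [Q₂;τ₂]`
  have hBd : ∀ᶠ u in 𝓝 (0 : ℝ), HasDerivAt (fun u => Matrix.of.symm (kkt (Matrix.of (E u)) (fromRows Q₂ τ₂)))
      ((fun u => Matrix.of.symm (kkt (Matrix.of (E₁ u)) (0 : Matrix (κ ⊕ ρ₂) μ ℝ))) u) u := by
    filter_upwards [hE'] with u huE
    exact hasDerivAt_kkt (Q := fun _ => Matrix.of.symm (fromRows Q₂ τ₂)) (Q' := (0 : Matrix (κ ⊕ ρ₂) μ ℝ)) huE (hasDerivAt_const u _)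
  have hB₁d : HasDerivAt (fun u => Matrix.of.symm (kkt (Matrix.of (E₁ u)) (0 : Matrix (κ ⊕ ρ₂) μ ℝ)))
      (Matrix.of.symm (kkt E₂ (0 : Matrix (κ ⊕ ρ₂) μ ℝ))) 0 :=
    hasDerivAt_kkt (Q := fun _ => Matrix.of.symm (0 : Matrix (κ ⊕ ρ₂) μ ℝ)) (Q' := (0 : Matrix (κ ⊕ ρ₂) μ ℝ)) hE₁ (hasDerivAt_const (0 : ℝ) _)
  -- non-degeneracy at `0` of the block system in effective-form dress, and of the one-shot system
  have hE0 : Matrix.of (E 0) = (effForm (PNᵀ * Matrix.of (H 0) * PN) (fromRows Q₁ τ₁)).toBlocks₁₁ := hEeq.self_of_nhds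
  have h2' : (kkt (effForm (PNᵀ * Matrix.of (H 0) * PN) (fromRows Q₁ τ₁)).toBlocks₁₁ (fromRows Q₂ τ₂)).det ≠ 0 := by rw [← hE0]; exact h2
  have hN0 : (kkt (PNᵀ * Matrix.of (H 0) * PN) (fromRows (Q₂ * Q₁) P)).det ≠ 0 :=
    det_kkt_oneShot_nestedDressed_ne_zero (Matrix.of (H 0)) Q₁ S₁ Sc W₁ W₂ hQW₁ hT hTc Qr hQr τ₁ hτ Q₂ hQQW₂ τ₂ hτc P hP h1 h2'
  -- non-degeneracy persists near `0`, hence the `log|det|` identity holds near `0` with the SAME constant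
  have hFne : ∀ᶠ u in 𝓝 (0 : ℝ), (Matrix.of (Matrix.of.symm (kkt (P1ᵀ * Matrix.of (H u) * P1) (fromRows Q₁ τ₁)))).det ≠ 0 :=
    eventually_det_ne_zero (hFd.self_of_nhds).hasFDerivAt h1
  have hBne : ∀ᶠ u in 𝓝 (0 : ℝ), (Matrix.of (Matrix.of.symm (kkt (Matrix.of (E u)) (fromRows Q₂ τ₂)))).det ≠ 0 :=
    eventually_det_ne_zero (hBd.self_of_nhds).hasFDerivAt h2
  set c : ℝ := 2 * Real.log |(P * fromCols W₂ W₁).det| - 2 * Real.log |(τ₁ * W₁).det| - 2 * Real.log |(τ₂ * (Q₁ * W₂)).det| with hc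
  have heq : ∀ᶠ u in 𝓝 (0 : ℝ),
      (1 : ℝ) * Real.log |(Matrix.of (Matrix.of.symm (kkt (PNᵀ * Matrix.of (H u) * PN) (fromRows (Q₂ * Q₁) P)))).det|
        + (-1) * Real.log |(Matrix.of (Matrix.of.symm (kkt (P1ᵀ * Matrix.of (H u) * P1) (fromRows Q₁ τ₁)))).det|
        + (-1) * Real.log |(Matrix.of (Matrix.of.symm (kkt (Matrix.of (E u)) (fromRows Q₂ τ₂)))).det|
        + 0 * Real.log |(Matrix.of (Matrix.of.symm (kkt (Matrix.of (E u)) (fromRows Q₂ τ₂)))).det| = c := by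
    filter_upwards [hFne, hBne, hEeq] with u huF huB huE
    have huF' : (kkt (P1ᵀ * Matrix.of (H u) * P1) (fromRows Q₁ τ₁)).det ≠ 0 := huF
    have huB' : (kkt (Matrix.of (E u)) (fromRows Q₂ τ₂)).det ≠ 0 := huB
    have hu1 : IsUnit (kkt (PNᵀ * Matrix.of (H u) * PN) (fromRows Q₁ τ₁)).det := by
      rw [hPN, det_kkt_nestedDressed_eq_fineDressed (Matrix.of (H u)) Q₁ τ₁ S₁ Sc W₁ W₂ hQW₁ hT hTc Qr hQr]
      exact isUnit_iff_ne_zero.mpr huF'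
    have hu2 : IsUnit (kkt (effForm (PNᵀ * Matrix.of (H u) * PN) (fromRows Q₁ τ₁)).toBlocks₁₁ (fromRows Q₂ τ₂)).det := by
      rw [← huE]; exact isUnit_iff_ne_zero.mpr huB'
    have hlog := log_abs_det_kkt_comp_nestedDressed (Matrix.of (H u)) Q₁ S₁ Sc W₁ W₂ hQW₁ hT hTc Qr hQr τ₁ hτ Q₂ hQQW₂ τ₂ hτc P hP hu1 hu2
    rw [← huE] at hlog
    show (1 : ℝ) * Real.log |(kkt (PNᵀ * Matrix.of (H u) * PN) (fromRows (Q₂ * Q₁) P)).det|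
        + (-1) * Real.log |(kkt (P1ᵀ * Matrix.of (H u) * P1) (fromRows Q₁ τ₁)).det|
        + (-1) * Real.log |(kkt (Matrix.of (E u)) (fromRows Q₂ τ₂)).det|
        + 0 * Real.log |(kkt (Matrix.of (E u)) (fromRows Q₂ τ₂)).det| = c
    rw [hlog, hc]; ring
  -- differentiate twice (`secondVar_comb_eq_zero` with coefficients `1, −1, −1, 0`)
  have h := secondVar_comb_eq_zero (a := 1) (b := -1) (c := -1) (d := 0) (k := c) (t := 0)
    hNd hN₁d hN0 hFd hF₁d h1 hBd hB₁d h2 hBd hB₁d h2 heq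
  simp only [one_mul, neg_one_mul, zero_mul, add_zero] at h
  have h' : secondVar (kkt (PNᵀ * Matrix.of (H 0) * PN) (fromRows (Q₂ * Q₁) P))
        (kkt (PNᵀ * Matrix.of (H₁ 0) * PN) (0 : Matrix (κ ⊕ (ρ₂ ⊕ ρ₁)) ν ℝ)) (kkt (PNᵀ * H₂ * PN) (0 : Matrix (κ ⊕ (ρ₂ ⊕ ρ₁)) ν ℝ))
      - secondVar (kkt (P1ᵀ * Matrix.of (H 0) * P1) (fromRows Q₁ τ₁))
          (kkt (P1ᵀ * Matrix.of (H₁ 0) * P1) (0 : Matrix (μ ⊕ ρ₁) ν ℝ)) (kkt (P1ᵀ * H₂ * P1) (0 : Matrix (μ ⊕ ρ₁) ν ℝ))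
      - secondVar (kkt (Matrix.of (E 0)) (fromRows Q₂ τ₂)) (kkt (Matrix.of (E₁ 0)) (0 : Matrix (κ ⊕ ρ₂) μ ℝ))
          (kkt E₂ (0 : Matrix (κ ⊕ ρ₂) μ ℝ)) = 0 := by
    have : ∀ x y z : ℝ, x + -y + -z = x - y - z := fun x y z => by ring
    rw [← this]; exact h
  linarith

omit [DecidableEq ν] in
/-- [folklore] A congruent of a symmetric matrix is symmetric: `(PᵀXP)ᵀ = PᵀXP` for `Xᵀ = X`. -/
theorem transpose_conj_of_symm {X P : Matrix ν ν ℝ} (hX : Xᵀ = X) : (Pᵀ * X * P)ᵀ = Pᵀ * X * P := by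
  rw [Matrix.transpose_mul, Matrix.transpose_mul, Matrix.transpose_transpose, hX, Matrix.mul_assoc]

/-- [folklore] **THE MODEL OF `TP (m+1) = RP m + TP m` — THE NESTED STEP LAW IN `hessKer`'S NORMALISATION** (`½·bubble − ½·tadpole` of each system written
with ITS OWN fluctuation covariance `Γ = flucCov`; `KKTSecondVariation.sixLoops_kkt_of_Q_static` ×3 on `secondVar_nestedStepLaw`).  With `Γ_N := flucCov (Π_nestᵀHΠ_nest) [Q₂Q₁;P]`,
`Γ₁ := flucCov (Π₁ᵀHΠ₁) [Q₁;τ₁]`, `Γ_B := flucCov E [Q₂;τ₂]` at `u = 0`, the dressed jets `K̇_N = Π_nestᵀH₁Π_nest`, `K̈_N = Π_nestᵀH₂Π_nest`, `K̇₁ = Π₁ᵀH₁Π₁`, `K̈₁ = Π₁ᵀH₂Π₁`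
and the block jets `Ė = E₁ 0`, `Ë = E₂` (symmetric form and jets):
`½tr(Γ_N K̇_N Γ_N K̇_N) − ½tr(Γ_N K̈_N) = [½tr(Γ₁ K̇₁ Γ₁ K̇₁) − ½tr(Γ₁ K̈₁)] + [½tr(Γ_B Ė Γ_B Ė) − ½tr(Γ_B Ë)]`.
READING for the road (memo §9 (9f)): LHS = `TP (m+1)` of the nested-dressed (m+1)-fold one shot (gluon resolvent `Γ_N = [KPerf (m+1)]_ff`, vertices = the nested-dressed jets);
first bracket = the literal's ONE-STEP `TP 1` read at the fine background jets (after transport through the coarse minimiser columns: `RP m`); second bracket = the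
block system's one-loop kernel with the COARSE TABLES `Ė`, `Ë` (= `TP m` once rows (J-S)∕(J-W) identify them with the m-fold perfect jets).  Nothing of the road's
perfect objects is instantiated here. -/
theorem hessWords_nestedStepLaw (Q₁ : Matrix μ ν ℝ) (S₁ : Matrix ρ₁ ν ℝ) (Sc : Matrix ρ₂ μ ℝ)
    (W₁ : Matrix ν ρ₁ ℝ) (W₂ : Matrix ν ρ₂ ℝ) (hQW₁ : Q₁ * W₁ = 0) (hT : IsUnit (S₁ * W₁).det) (hTc : IsUnit (Sc * (Q₁ * W₂)).det)
    (Qr : Matrix ν μ ℝ) (hQr : Q₁ * Qr = 1)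
    (τ₁ : Matrix ρ₁ ν ℝ) (hτ : IsUnit (τ₁ * W₁).det) (Q₂ : Matrix κ μ ℝ) (hQQW₂ : Q₂ * (Q₁ * W₂) = 0) (τ₂ : Matrix ρ₂ μ ℝ)
    (hτc : IsUnit (τ₂ * (Q₁ * W₂)).det) (P : Matrix (ρ₂ ⊕ ρ₁) ν ℝ) (hP : IsUnit (P * fromCols W₂ W₁).det)
    -- the two dressings, NAMED (instantiate with `rfl`)
    {PN P1 : Matrix ν ν ℝ} (hPN : PN = 1 - fromCols W₂ W₁ * (fromRows (Sc * Q₁) S₁ * fromCols W₂ W₁)⁻¹ * fromRows (Sc * Q₁) S₁)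
    (hP1 : P1 = 1 - W₁ * (S₁ * W₁)⁻¹ * S₁)
    -- the form curve and its jets at `0`
    {H H₁ : ℝ → ν → ν → ℝ} {H₀ K₁ H₂ : Matrix ν ν ℝ}
    (hH : ∀ᶠ u in 𝓝 (0 : ℝ), HasDerivAt H (H₁ u) u) (hH₁ : HasDerivAt H₁ (Matrix.of.symm H₂) 0)
    (hH0 : Matrix.of (H 0) = H₀) (hH₁0 : Matrix.of (H₁ 0) = K₁) (hHs : H₀ᵀ = H₀) (hK₁s : K₁ᵀ = K₁)
    -- the block curve and its jets at `0`
    {E E₁ : ℝ → μ → μ → ℝ} {E₀ F₁ E₂ : Matrix μ μ ℝ}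
    (hE : ∀ᶠ u in 𝓝 (0 : ℝ), HasDerivAt E (E₁ u) u) (hE₁ : HasDerivAt E₁ (Matrix.of.symm E₂) 0)
    (hE0 : Matrix.of (E 0) = E₀) (hE₁0 : Matrix.of (E₁ 0) = F₁) (hEs : E₀ᵀ = E₀) (hF₁s : F₁ᵀ = F₁)
    (hEeq : ∀ᶠ u in 𝓝 (0 : ℝ), Matrix.of (E u) = (effForm (PNᵀ * Matrix.of (H u) * PN) (fromRows Q₁ τ₁)).toBlocks₁₁)
    -- non-degeneracy at `0`
    (h1 : (kkt (P1ᵀ * H₀ * P1) (fromRows Q₁ τ₁)).det ≠ 0) (h2 : (kkt E₀ (fromRows Q₂ τ₂)).det ≠ 0) :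
    (1 / 2 : ℝ) * (flucCov (PNᵀ * H₀ * PN) (fromRows (Q₂ * Q₁) P) * (PNᵀ * K₁ * PN)
          * (flucCov (PNᵀ * H₀ * PN) (fromRows (Q₂ * Q₁) P) * (PNᵀ * K₁ * PN))).trace
      - (1 / 2 : ℝ) * (flucCov (PNᵀ * H₀ * PN) (fromRows (Q₂ * Q₁) P) * (PNᵀ * H₂ * PN)).trace
    = ((1 / 2 : ℝ) * (flucCov (P1ᵀ * H₀ * P1) (fromRows Q₁ τ₁) * (P1ᵀ * K₁ * P1)
            * (flucCov (P1ᵀ * H₀ * P1) (fromRows Q₁ τ₁) * (P1ᵀ * K₁ * P1))).trace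
        - (1 / 2 : ℝ) * (flucCov (P1ᵀ * H₀ * P1) (fromRows Q₁ τ₁) * (P1ᵀ * H₂ * P1)).trace)
      + ((1 / 2 : ℝ) * (flucCov E₀ (fromRows Q₂ τ₂) * F₁ * (flucCov E₀ (fromRows Q₂ τ₂) * F₁)).trace
        - (1 / 2 : ℝ) * (flucCov E₀ (fromRows Q₂ τ₂) * E₂).trace) := by
  subst hH0 hH₁0 hE0 hE₁0 hPN hP1
  have h := secondVar_nestedStepLaw Q₁ S₁ Sc W₁ W₂ hQW₁ hT hTc Qr hQr τ₁ hτ Q₂ hQQW₂ τ₂ hτc P hP hH hH₁ hE hE₁ hEeq h1 h2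
  have eN := sixLoops_kkt_of_Q_static
    ((1 - fromCols W₂ W₁ * (fromRows (Sc * Q₁) S₁ * fromCols W₂ W₁)⁻¹ * fromRows (Sc * Q₁) S₁)ᵀ * Matrix.of (H 0) *
      (1 - fromCols W₂ W₁ * (fromRows (Sc * Q₁) S₁ * fromCols W₂ W₁)⁻¹ * fromRows (Sc * Q₁) S₁))
    ((1 - fromCols W₂ W₁ * (fromRows (Sc * Q₁) S₁ * fromCols W₂ W₁)⁻¹ * fromRows (Sc * Q₁) S₁)ᵀ * Matrix.of (H₁ 0) *
      (1 - fromCols W₂ W₁ * (fromRows (Sc * Q₁) S₁ * fromCols W₂ W₁)⁻¹ * fromRows (Sc * Q₁) S₁))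
    ((1 - fromCols W₂ W₁ * (fromRows (Sc * Q₁) S₁ * fromCols W₂ W₁)⁻¹ * fromRows (Sc * Q₁) S₁)ᵀ * H₂ *
      (1 - fromCols W₂ W₁ * (fromRows (Sc * Q₁) S₁ * fromCols W₂ W₁)⁻¹ * fromRows (Sc * Q₁) S₁))
    (fromRows (Q₂ * Q₁) P) (transpose_conj_of_symm hHs) (transpose_conj_of_symm hK₁s)
  have eF := sixLoops_kkt_of_Q_static ((1 - W₁ * (S₁ * W₁)⁻¹ * S₁)ᵀ * Matrix.of (H 0) * (1 - W₁ * (S₁ * W₁)⁻¹ * S₁))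
    ((1 - W₁ * (S₁ * W₁)⁻¹ * S₁)ᵀ * Matrix.of (H₁ 0) * (1 - W₁ * (S₁ * W₁)⁻¹ * S₁)) ((1 - W₁ * (S₁ * W₁)⁻¹ * S₁)ᵀ * H₂ * (1 - W₁ * (S₁ * W₁)⁻¹ * S₁))
    (fromRows Q₁ τ₁) (transpose_conj_of_symm hHs) (transpose_conj_of_symm hK₁s)
  have eB := sixLoops_kkt_of_Q_static (Matrix.of (E 0)) (Matrix.of (E₁ 0)) E₂ (fromRows Q₂ τ₂) hEs hF₁s
  linarith [h, eN, eF, eB]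

end SecondVar

end Summit.QuantumFields.BalabanUV.Beta.FP.NestedDressingHessian

end
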